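import Summits.Parity.GeneralizedHardyLittlewood.Theorems.PrimeLevelFamEdgeMomentsBeyondDiagonalDiagRemBothSidedDecorFour
import Summits.Parity.GeneralizedHardyLittlewood.Theorems.PrimeLevelFamEdgeMomentsBeyondDiagonalDiagRemD4TailBoundPow
import HarnessLib

/-!
# Route `PrimeLevelFamEdge`, crux K_A `MomentsBeyondDiagonal` (stmt-Parity-20007), line «petersson_layers» v4, stub `stub_diag`:
# **the both-sided monomial `a_nD₄ ⊗ a_nD₄ · R` — UNCONDITIONAL** (brick of (R₄₄); `…DiagRemBothSidedDecorFour` with its hypothesis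
# «D4TAIL»_A discharged by `…DiagRemD4TailBoundPow.abs_sum_copTauW_decorFour_sub_le_pow`)

With «D4TAIL»_A proved (g17, the `t`-deformation route: `…DiagRemMoebiusLogPow`, `…HyperbolaProduct`, `…Rademacher`, `…DeformedIdentity`,
`…DeformedKernel`, `…DeformedLocal`, `…DeformedLocalSqf`, `…DeformedLocalSum`, `…ConvTailPow`, `…D4TailBoundPow`), the last both-sided
type of the order-`(4,4)` remainder weight (family `Ψ_DD` of `…DiagRemFourFourMonomials.abs_monomial_weight_le₄₄`) needs no hypothesis:

* `abs_bothsided_decorFour_decorFour_le_pow` — `…_of A (abs_sum_copTauW_decorFour_sub_le_pow A)`: for an abstract kernel `R` with the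
  two-sequence Abel estimate `hR2` and the pointwise bounds `hRs`/`hRt`,
  `|Σ_{k₁,k₂≤Y}(a_nD₄)(k₁)(a_nD₄)(k₂)ℓ⁺ⁱℓ⁺ʲR(αk₁k₂)| ≤ log^{i+j}Y·C₀·((3(L + C_PD)L + 3C_PD(L + C_PD) + (C_PD)²)√(2αK₁Y) +
  (18L·C_PD + 19(C_PD)²)x^N/(1+log K₁)^A)`, `L = 5(1+log Y)⁶`.

So every brick type of (R₄₄) is now in the tree unconditionally; what remains for RUNG 4 of `stub_diag` is the templated inner sum (B4) and
estimate (B5) of `Cruxes/MomentsBeyondDiagonal/Lines/petersson_layers_stub_diag_g16_order44.md` §«EXACT REMAINING LIST».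

Def-free; theorems only. Helper `--supports stmt-Parity-20007`; closes nothing; K_A, K_B and the Parity summit are NOT proved;
nothing about Landau–Siegel zeros.

## References
* E. Kowalski, P. Michel, J. VanderKam, J. reine angew. Math. 526 (2000), Prop. 5.1 p. 18.
  [cite: KowalskiMichelVanderKam2000, Prop. 5.1 — derivation (both-sided decorated remainder monomials, any order)]
-/

noncomputable section

open Real Finset

namespace Summit.Parity.GeneralizedHardyLittlewood.Theorems.MomentsBeyondDiagonal.DiagCorner

open Summit.Parity.GeneralizedHardyLittlewood.Theorems.BeyondDiagonalBeatsQuarter.KernelFormXSq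
  (copTauW divWeight)
open Summit.Parity.GeneralizedHardyLittlewood.Theorems.BeyondDiagonalBeatsQuarter.Corner

/-- **The both-sided monomial `a_nD₄ ⊗ a_nD₄ · R`, unconditional** (the `_of` version with «D4TAIL»_A discharged).
[cite: KowalskiMichelVanderKam2000, Prop. 5.1 — derivation (both-sided decorated remainder monomial)] -/
theorem abs_bothsided_decorFour_decorFour_le_pow (A : ℕ)
    {N M : ℕ} (hMN : M ≤ N) {R : ℝ → ℝ} {C₀ : ℝ} (hC₀ : 0 ≤ C₀)
    (hR2 : ∀ (a₁ a₂ : ℕ → ℝ) (Y α B η : ℝ) (K₁ i j : ℕ), 1 ≤ Y → 0 < α → 1 ≤ i → 1 ≤ j →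
      (∀ e : ℕ, e ≤ ⌊Y⌋₊ → |∑ k ∈ Icc 1 e, a₂ k| ≤ B) → (∀ e : ℕ, K₁ ≤ e → |∑ k ∈ Icc 1 e, a₁ k| ≤ η) →
      2 * α * K₁ * Y ≤ 1 →
    |∑ k₁ ∈ Icc 1 ⌊Y⌋₊, ∑ k₂ ∈ Icc 1 ⌊Y⌋₊,
        a₁ k₁ * a₂ k₂ * ellp Y k₁ ^ i * ellp Y k₂ ^ j * R (α * k₁ * k₂)| ≤
      (∑ k ∈ Icc 1 ⌊Y⌋₊, |a₁ k| * ellp Y k ^ i) * (B * (Real.log Y ^ j * (3 * C₀ * Real.sqrt (2 * α * K₁ * Y)))) +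
        (∑ k ∈ Icc 1 ⌊Y⌋₊, |a₂ k| * ellp Y k ^ j) *
          ((2 * η) * (Real.log Y ^ i * (9 * C₀ * (1 + |Real.log (2 * α * Y ^ 2)|) ^ N))))
    (hRs : ∀ y : ℝ, 0 < y → y ≤ 1 → |R y| ≤ C₀ * Real.sqrt y)
    (hRt : ∀ y : ℝ, 1 ≤ y → |R y| ≤ C₀ * (1 + Real.log y) ^ M) :
    ∃ C_P : ℝ, 0 ≤ C_P ∧
    (∀ n : ℕ, n ≠ 0 → ∀ (Y α : ℝ) (K₁ i j : ℕ), 1 ≤ Y → 0 < α → 1 ≤ i → 1 ≤ j → 2 * α * K₁ * Y ≤ 1 →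
    |∑ k₁ ∈ Icc 1 ⌊Y⌋₊, ∑ k₂ ∈ Icc 1 ⌊Y⌋₊,
        (copTauW n k₁ * (3 * (∑ p ∈ k₁.primeFactors, Real.log p ^ 2) ^ 2 - 2 * ∑ p ∈ k₁.primeFactors, Real.log p ^ 4)) *
          (copTauW n k₂ * (3 * (∑ p ∈ k₂.primeFactors, Real.log p ^ 2) ^ 2 - 2 * ∑ p ∈ k₂.primeFactors, Real.log p ^ 4)) * ellp Y k₁ ^ i * ellp Y k₂ ^ j *
          R (α * k₁ * k₂)| ≤
      Real.log Y ^ (i + j) * (C₀ *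
        ((3 * ((5 * (1 + Real.log Y) ^ 6) + C_P * divWeight n) * (5 * (1 + Real.log Y) ^ 6) +
            3 * (C_P * divWeight n) * ((5 * (1 + Real.log Y) ^ 6) + C_P * divWeight n) + (C_P * divWeight n) ^ 2) *
            Real.sqrt (2 * α * K₁ * Y) +
          (18 * (5 * (1 + Real.log Y) ^ 6) * (C_P * divWeight n) + 19 * (C_P * divWeight n) ^ 2) *
            (1 + |Real.log (2 * α * Y ^ 2)|) ^ N / (1 + Real.log K₁) ^ A))) :=
  abs_bothsided_decorFour_decorFour_le_pow_of A (abs_sum_copTauW_decorFour_sub_le_pow A) hMN hC₀ hR2 hRs hRt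

end Summit.Parity.GeneralizedHardyLittlewood.Theorems.MomentsBeyondDiagonal.DiagCorner

end
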